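/-
Copyright (c) 2026. All rights reserved.
Released under Apache 2.0 license as described in the file LICENSE.
Authors: abc-iut cell, wave-3 discharge seat abc-iut-L6-d2 (gen 2) (proof-only bridge: the
pre-log-shell of [AbsTopIII] Def 3.1 (iv) inside `k̄` IS the log-shell data of Def 5.4 (iii) /
[IUTchIII] Def 1.1 (i) computed from the real `p`-adic logarithm of the base field).
-/
import Literature.AnabelianGeometry.AbsoluteAnabelian.GaloisPadicLogTower
import Literature.AnabelianGeometry.AbsoluteAnabelian.MLFClosureUnitsInfinitelyDivisible
import Literature.AnabelianGeometry.AbsoluteAnabelian.LogShellsOfUnitLog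
import Literature.IUT.LogVolume.PadicSubfields
import Literature.IUT.LogVolume.LogShellTopology
import Literature.AnabelianGeometry.AbsoluteAnabelian.GaloisPadicLogPerfection
import Literature.AnabelianGeometry.AbsoluteAnabelian.GaloisPadicLogMLF
import HarnessLib

/-!
# The pre-log-shell of `log_k̄` ([AbsTopIII] Def 3.1 (iv)) versus the log-shell `ℐ_k` (Def 5.4 (iii))

S. Mochizuki, *Topics in absolute anabelian geometry III* [MochizukiAbsTopIII2015], Def 3.1 (iv),
manuscript p. 69: the pre-log-shell is "the compact submodule of `k~ = (𝒪_k̄^×)^pf` determined by the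
image of the subgroup `𝒪_k^× = (𝒪_k̄^×)^{Π_k}`", i.e. — in the coordinates `log_k̄ : k~ ⥲ k̄` —
`log_k̄((𝒪_k̄^×)^{G_k}) ⊆ k ⊆ k̄`; Def 5.4 (iii) p. 126: the log-shell is `ℐ_k := (p*)⁻¹ · log_k(𝒪_k^×)`;
[IUTchIII] Def 1.1 (i) p. 24: `ℐ_{†F_v} ⊆ log(†F_v)` is this `ℐ_k` inside the codomain of the log-link.

Three seats typed three avatars: abc-iut-L4-t2 `GaloisPadicLog.preLogShell L` (an `AddSubgroup` of
`k̄`, over the hypothesis structure `GaloisPadicLog k k̄`), abc-iut-L4-t3 `logShell (L : PadicLogOnUnits k)`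
(a subset of `k`), abc-iut-S1 `logUnits k = log_p(𝒪_k^×)` with the REAL logarithm `unitLog`; the
standard model `PadicLogOnUnits.ofUnitLog p k` (abc-iut-L3-t11) identifies the last two
(`logShell_ofUnitLog`), and the volume of `ℐ_k` is computed there (this seat, gen 0:
`HolomorphicLogShellVolume.lean`). THIS PROOF-ONLY FILE closes the triangle for every finite
`k = E ⊆ ℚ̄_p` (the setting "`k_i ⊆ ℚ̄_p`" of [IUTchIV] Prop 1.1), for the REAL `log_k̄ = padicLogAlgCl`
of `GaloisPadicLog.ofPadicSubfield E` (`GaloisPadicLogTower.lean`):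

* `invariantUnits_subfield_eq` — `(𝒪_k̄^×)^{G_E} = 𝒪_E^× = {u ∈ E : ‖u‖ = 1}` inside `ℚ̄_p`
  (abc-iut-L6-t11's Galois descent `invariantUnits_eq_image` + `valuation_subfield_eq_one_iff`);
* `log_image_invariantUnits_subfield` — `log_k̄((𝒪_k̄^×)^{G_E}) = log_p(𝒪_E^×) = logUnits E`
  (abc-iut-S1's compatibility `coe_unitLog_eq_padicLogAlgCl` of the two real logarithms);
* `preLogShell_ofPadicSubfield` — **the pre-log-shell of Def 3.1 (iv) IS `log_p(𝒪_E^×)`** (as the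
  image of S1's `logUnitsAddSubgroup p E` in `ℚ̄_p`);
* `pstar_inv_smul_preLogShell_ofPadicSubfield` — **`(p*)⁻¹ ·` pre-log-shell `= ℐ_E`**, the log-shell
  of Def 5.4 (iii) / [IUTchIII] Def 1.1 (i) of the standard model `PadicLogOnUnits.ofUnitLog p E`,
  placed inside `k̄ = log(†F_v)` — so every volume statement of the log-shell lane
  (`localLogVolume_logShell_ofUnitLog_eq`, `holMonoVolumeCompatible_ofUnitLog`, …) is a statement
  about the pre-log-shell of the GALOIS-side logarithm.
* `GaloisPadicLog.preLogShell_eq_closure_image_units` — for ANY `MLFClosure` and any `L`, the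
  pre-log-shell is generated by `log_k̄(𝒪_k^×)` (units of valuation `1` of `k`).

Classical; no definitions; nothing here bears on [IUTchIII] Cor. 3.12; typed ≠ discharged.
-/

set_option autoImplicit false

noncomputable section

namespace Literature.AnabelianGeometry.AbsoluteAnabelian

open Set ValuativeRel
open scoped ValuativeRel Pointwise
open Literature.NumberTheory.Transcendental Literature.IUT.LogVolume

universe u

/-! ## Any `MLFClosure`: the pre-log-shell is generated by `log_k̄(𝒪_k^×)` -/

/-- For an MLF `k` with algebraic closure `k̄` and any `log_k̄`, the pre-log-shell of Def 3.1 (iv) is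
the subgroup of `k̄` generated by `log_k̄` of (the images of) the elements of `k` of valuation `1`
(abc-iut-L6-t11's `(𝒪_k̄^×)^{G_k} = 𝒪_k^×`). [cite: MochizukiAbsTopIII2015, Definition 3.1 (iv) p.69] -/
theorem GaloisPadicLog.preLogShell_eq_closure_image_units (C : MLFClosure.{u})
    (L : GaloisPadicLog C.k C.K) :
    L.preLogShell =
      AddSubgroup.closure (L.log '' (algebraMap C.k C.K '' {u : C.k | valuation C.k u = 1})) := by
  rw [GaloisPadicLog.preLogShell, invariantUnits_eq_image]

/-! ## Finite `E ⊆ ℚ̄_p`: the three avatars coincide -/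

section Subfield

variable {p : ℕ} [hp : Fact p.Prime] (E : IntermediateField ℚ_[p] (PadicAlgCl p))

/-- `ℚ̄_p` is an algebraic closure of every intermediate field `E`.
[cite: MochizukiAbsTopIII2015, Definition 3.1 (i) p.66] -/
theorem PadicAlgCl.isAlgClosure_subfield : IsAlgClosure E (PadicAlgCl p) :=
  { isAlgClosed := inferInstance
    isAlgebraic := Algebra.IsAlgebraic.tower_top (K := ℚ_[p]) E }

/-- For the valuative relation of the absolute value on `E`, `v(u) = 1 ↔ ‖u‖ = 1`.
[cite: MochizukiAbsTopIII2015, Definition 3.1 (i) p.66] -/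
theorem PadicAlgCl.valuation_subfield_eq_one_iff (u : E) :
    letI := PadicAlgCl.subfieldValuativeRel E
    valuation E u = 1 ↔ ‖(u : PadicAlgCl p)‖ = 1 := by
  letI := PadicAlgCl.subfieldValuativeRel E
  haveI hc : ((Valued.v (R := PadicAlgCl p)).comap (algebraMap E (PadicAlgCl p))).Compatible :=
    Valuation.Compatible.ofValuation _
  have h1 : valuation E u ≤ 1 ↔ ‖(u : PadicAlgCl p)‖ ≤ 1 := by
    rw [← Valuation.mem_integer_iff]
    exact PadicAlgCl.mem_integer_subfield_iff E u
  have h2 : 1 ≤ valuation E u ↔ 1 ≤ ‖(u : PadicAlgCl p)‖ := by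
    rw [← Valuation.one_vle_iff (valuation E),
      Valuation.one_vle_iff ((Valued.v (R := PadicAlgCl p)).comap (algebraMap E (PadicAlgCl p))),
      Valuation.comap_apply, PadicAlgCl.valuation_def, ← NNReal.coe_le_coe, coe_nnnorm, NNReal.coe_one]
    rfl
  rw [le_antisymm_iff, le_antisymm_iff, h1, h2]

/-- **`(𝒪_k̄^×)^{G_E} = 𝒪_E^×`** inside `ℚ̄_p`: the `Gal(ℚ̄_p/E)`-invariant units of `𝒪_{ℚ̄_p}` are exactly
the elements of `E` of absolute value `1`. [cite: MochizukiAbsTopIII2015, Definition 3.1 (iv) p.69] -/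
theorem invariantUnits_subfield_eq :
    @invariantUnits E _ (PadicAlgCl.subfieldValuativeRel E) (PadicAlgCl p) _ _ =
      algebraMap E (PadicAlgCl p) '' {u : E | ‖u‖ = 1} := by
  letI := PadicAlgCl.subfieldValuativeRel E
  haveI := PadicAlgCl.isAlgClosure_subfield E
  rw [invariantUnits_eq_image]
  congr 1
  ext u
  rw [mem_setOf_eq, mem_setOf_eq, PadicAlgCl.valuation_subfield_eq_one_iff E u]
  rfl

variable [FiniteDimensional ℚ_[p] E]

/-- **`log_k̄((𝒪_k̄^×)^{G_E}) = log_p(𝒪_E^×)`**: on the invariant units the Galois-side logarithm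
`padicLogAlgCl` is abc-iut-S1's `unitLog` of `E` (compatibility `coe_unitLog_eq_padicLogAlgCl`), so its
image is the image in `ℚ̄_p` of `logUnits E`. [cite: MochizukiAbsTopIII2015, Definition 3.1 (iv) p.69] -/
theorem log_image_invariantUnits_subfield :
    padicLogAlgCl p '' @invariantUnits E _ (PadicAlgCl.subfieldValuativeRel E) (PadicAlgCl p) _ _ =
      algebraMap E (PadicAlgCl p) '' logUnits E := by
  rw [invariantUnits_subfield_eq, logUnits, Set.image_image, Set.image_image]
  refine Set.image_congr fun u hu => ?_
  rw [mem_setOf_eq] at hu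
  exact (coe_unitLog_eq_padicLogAlgCl p E hu).symm

/-- **The pre-log-shell of [AbsTopIII] Def 3.1 (iv) for the real `log_k̄` over `E` IS `log_p(𝒪_E^×)`**:
`(GaloisPadicLog.ofPadicSubfield E).preLogShell` = the image in `ℚ̄_p` of abc-iut-S1's
`logUnitsAddSubgroup p E`. [cite: MochizukiAbsTopIII2015, Definition 3.1 (iv) p.69] -/
theorem preLogShell_ofPadicSubfield :
    letI := PadicAlgCl.subfieldValuativeRel E
    (GaloisPadicLog.ofPadicSubfield E).preLogShell =
      (logUnitsAddSubgroup p E).map (algebraMap E (PadicAlgCl p)).toAddMonoidHom := by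
  letI := PadicAlgCl.subfieldValuativeRel E
  apply le_antisymm
  · rw [GaloisPadicLog.preLogShell, AddSubgroup.closure_le, GaloisPadicLog.ofPadicSubfield_log,
      log_image_invariantUnits_subfield, AddSubgroup.coe_map]
    exact subset_rfl
  · rw [GaloisPadicLog.preLogShell, GaloisPadicLog.ofPadicSubfield_log, log_image_invariantUnits_subfield]
    rintro _ ⟨z, hz, rfl⟩
    exact AddSubgroup.subset_closure ⟨z, hz, rfl⟩

/-- The pre-log-shell, as a subset of `ℚ̄_p`, is the image of `logUnits E = log_p(𝒪_E^×)`.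
[cite: MochizukiAbsTopIII2015, Definition 3.1 (iv) p.69] -/
theorem coe_preLogShell_ofPadicSubfield :
    letI := PadicAlgCl.subfieldValuativeRel E
    ((GaloisPadicLog.ofPadicSubfield E).preLogShell : Set (PadicAlgCl p)) =
      algebraMap E (PadicAlgCl p) '' logUnits E := by
  letI := PadicAlgCl.subfieldValuativeRel E
  rw [preLogShell_ofPadicSubfield, AddSubgroup.coe_map]
  rfl

omit [FiniteDimensional ℚ_[p] E] in
/-- The embedding `E → ℚ̄_p` intertwines the scalings by `(p*)⁻¹` (`p* = p`, resp. `4`).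
[cite: MochizukiAbsTopIII2015, Def 5.4 (iii) p. 126] -/
theorem image_pstar_inv_smul (S : Set E) :
    algebraMap E (PadicAlgCl p) '' (((p ^ (if p = 2 then 2 else 1) : ℕ) : E)⁻¹ • S) =
      ((p ^ (if p = 2 then 2 else 1) : ℕ) : PadicAlgCl p)⁻¹ • (algebraMap E (PadicAlgCl p) '' S) := by
  ext y
  simp only [Set.mem_image, Set.mem_smul_set, smul_eq_mul]
  constructor
  · rintro ⟨x, ⟨s, hs, rfl⟩, rfl⟩
    exact ⟨algebraMap E (PadicAlgCl p) s, ⟨s, hs, rfl⟩, by rw [map_mul, map_inv₀, map_natCast]⟩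
  · rintro ⟨_, ⟨s, hs, rfl⟩, rfl⟩
    exact ⟨((p ^ (if p = 2 then 2 else 1) : ℕ) : E)⁻¹ * s, ⟨s, hs, rfl⟩,
      by rw [map_mul, map_inv₀, map_natCast]⟩

/-- **`(p*)⁻¹ ·` pre-log-shell `= ℐ_E`**: scaling the pre-log-shell of the Galois-side `log_k̄` by
`(p*)⁻¹` gives the log-shell of [AbsTopIII] Def 5.4 (iii) / [IUTchIII] Def 1.1 (i) of the standard model
`PadicLogOnUnits.ofUnitLog p E` (abc-iut-L4-t3 / L3-t11), embedded in `k̄`.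
[cite: MochizukiAbsTopIII2015, Def 5.4 (iii) p. 126] -/
theorem pstar_inv_smul_preLogShell_ofPadicSubfield :
    letI := PadicAlgCl.subfieldValuativeRel E
    ((p ^ (if p = 2 then 2 else 1) : ℕ) : PadicAlgCl p)⁻¹ •
        ((GaloisPadicLog.ofPadicSubfield E).preLogShell : Set (PadicAlgCl p)) =
      algebraMap E (PadicAlgCl p) '' logShell (PadicLogOnUnits.ofUnitLog p E) := by
  letI := PadicAlgCl.subfieldValuativeRel E
  rw [coe_preLogShell_ofPadicSubfield, logShell_ofUnitLog, image_pstar_inv_smul]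

/-- Consequently the log-shell `ℐ_E ⊆ k̄` contains the pre-log-shell and `𝒪_E` (Def 5.4 (iii):
"`𝒪_{k~}^{Π_k} ⊆ ℐ`", via abc-iut-L3-t11's `closedBall_subset_logShell_ofUnitLog`), now for the Galois-side
logarithm. [cite: MochizukiAbsTopIII2015, Def 5.4 (iii) p. 126] -/
theorem image_closedBall_subset_pstar_inv_smul_preLogShell :
    letI := PadicAlgCl.subfieldValuativeRel E
    algebraMap E (PadicAlgCl p) '' Metric.closedBall (0 : E) 1 ⊆
      ((p ^ (if p = 2 then 2 else 1) : ℕ) : PadicAlgCl p)⁻¹ •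
        ((GaloisPadicLog.ofPadicSubfield E).preLogShell : Set (PadicAlgCl p)) := by
  letI := PadicAlgCl.subfieldValuativeRel E
  rw [pstar_inv_smul_preLogShell_ofPadicSubfield]
  exact Set.image_mono (closedBall_subset_logShell_ofUnitLog p E)

/-! ### The "natural compactum" of Def 3.1 (iv) is compact (appended) -/

/-- **[AbsTopIII] Def 3.1 (iv): the pre-log-shell IS a compactum** (p. 69 l. 61–66: "the subfield of
Galois-invariants “`(k~)^{Π_k}`” of the field “`k~`” obtained by the above construction […] is equipped
with a natural “compactum” — i.e., the compact submodule of `k~ = (𝒪_k̄^×)^pf` determined by the image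
of the subgroup `𝒪_k^× = (𝒪_k̄^×)^{Π_k} ⊆ 𝒪_k̄^×` of Galois-invariants of `𝒪_k̄^×`"): for the real `log_k̄`
over a finite `E ⊆ ℚ̄_p`, the pre-log-shell is a
COMPACT subset of `k̄ = ℚ̄_p` (it is the image of abc-iut-S1's compact `log_p(𝒪_E^×)`,
`isCompact_logUnits`, under the continuous inclusion `E ⊆ ℚ̄_p`). This is the topological clause that
`MLFGaloisModel.lean` records as not typed. [cite: MochizukiAbsTopIII2015, Definition 3.1 (iv) p.69] -/
theorem isCompact_coe_preLogShell_ofPadicSubfield :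
    letI := PadicAlgCl.subfieldValuativeRel E
    IsCompact (((GaloisPadicLog.ofPadicSubfield E).preLogShell : AddSubgroup (PadicAlgCl p)) :
      Set (PadicAlgCl p)) := by
  letI := PadicAlgCl.subfieldValuativeRel E
  rw [coe_preLogShell_ofPadicSubfield]
  exact (isCompact_logUnits p E).image continuous_subtype_val

/-- … and so is the log-shell `ℐ_E = (p*)⁻¹ ·` pre-log-shell inside `k̄` ([IUTchIII] Prop 1.2 (v) (a^{non})
"`ℐ_{†F_v}` is compact" — cf. this seat's `isCompact_logShell_ofUnitLog` at the base-field level).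
[cite: MochizukiAbsTopIII2015, Def 5.4 (iii) p. 126] -/
theorem isCompact_pstar_inv_smul_preLogShell_ofPadicSubfield :
    letI := PadicAlgCl.subfieldValuativeRel E
    IsCompact (((p ^ (if p = 2 then 2 else 1) : ℕ) : PadicAlgCl p)⁻¹ •
      ((GaloisPadicLog.ofPadicSubfield E).preLogShell : Set (PadicAlgCl p))) := by
  letI := PadicAlgCl.subfieldValuativeRel E
  exact (isCompact_coe_preLogShell_ofPadicSubfield E).smul _

/-! ### B9 (c) for the real logarithm: the multiplicative log-shell IS `ℐ_E` (appended) -/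

/-- **[IUTchII] Ex 1.8 (ix) / [AbsTopIII] Prop 5.8 (ii) ↔ Def 5.4 (iii), for the real logarithm over a
finite `E ⊆ ℚ̄_p`**: under `log_k̄ : k~ = 𝒪_k̄^×⧸𝒪_k̄^μ ⥲ k̄`, the MULTIPLICATIVE log-shell
`{y : y^{p*} ∈ image of (𝒪_k̄^×)^{G_E}}` (`multLogShell E ℚ̄_p (p*)`, the shape of abc-iut-L6-t1's
`AbsTopMonoids.logShell`; `p* = p`, resp. `4`) is mapped ONTO the ADDITIVE log-shell
`ℐ_E = (p*)⁻¹·log_p(𝒪_E^×)` of abc-iut-L4-t3's `logShell` at abc-iut-L3-t11's standard model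
`PadicLogOnUnits.ofUnitLog p E`, embedded in `k̄ = ℚ̄_p` — plan/L6/MERGE-MAP §8 B9 (c) «carrier change
mult→add» for the real objects. [cite: MochizukiAbsTopIII2015, Def 5.4 (iii) p. 126] -/
theorem toAdd_logEquiv_image_multLogShell_ofPadicSubfield :
    letI := PadicAlgCl.subfieldValuativeRel E
    (fun y => Multiplicative.toAdd ((GaloisPadicLog.ofPadicSubfield E).logEquiv y)) ''
        multLogShell E (PadicAlgCl p) (p ^ (if p = 2 then 2 else 1)) =
      algebraMap E (PadicAlgCl p) '' logShell (PadicLogOnUnits.ofUnitLog p E) := by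
  letI := PadicAlgCl.subfieldValuativeRel E
  haveI : CharZero (PadicAlgCl p) :=
    charZero_of_injective_algebraMap (algebraMap ℚ_[p] (PadicAlgCl p)).injective
  rw [GaloisPadicLog.toAdd_logEquiv_image_multLogShell _ (pow_pos hp.out.pos _),
    GaloisPadicLog.ofPadicSubfield_log, log_image_invariantUnits_subfield, logShell_ofUnitLog,
    image_pstar_inv_smul]

/-- In particular the multiplicative log-shell maps INTO `(p*)⁻¹ ·` pre-log-shell `= ℐ_E` and its image is
compact. [cite: MochizukiAbsTopIII2015, Def 5.4 (iii) p. 126] -/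
theorem isCompact_toAdd_logEquiv_image_multLogShell_ofPadicSubfield :
    letI := PadicAlgCl.subfieldValuativeRel E
    IsCompact ((fun y => Multiplicative.toAdd ((GaloisPadicLog.ofPadicSubfield E).logEquiv y)) ''
        multLogShell E (PadicAlgCl p) (p ^ (if p = 2 then 2 else 1))) := by
  letI := PadicAlgCl.subfieldValuativeRel E
  rw [toAdd_logEquiv_image_multLogShell_ofPadicSubfield, ← pstar_inv_smul_preLogShell_ofPadicSubfield]
  exact isCompact_pstar_inv_smul_preLogShell_ofPadicSubfield E

end Subfield

/-! ### Galois descent: the pre-log-shell lies in `k ⊆ k̄` (appended) -/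

/-- **[AbsTopIII] Def 3.1 (iv): the pre-log-shell lies in `(k~)^{Π_k} = k`.** For every MLF `k` with
algebraic closure `k̄` and every `log_k̄` (any `GaloisPadicLog`), the pre-log-shell is contained in the
image of `k` in `k̄`: it consists of `G_k`-invariants (abc-iut-L4-t2's `smul_eq_self_of_mem_preLogShell`),
and `k̄^{G_k} = k` by Galois descent (`k̄/k` Galois in characteristic `0`).
[cite: MochizukiAbsTopIII2015, Definition 3.1 (iv) p.69] -/
theorem GaloisPadicLog.coe_preLogShell_subset_range_algebraMap (C : MLFClosure.{u})
    (L : GaloisPadicLog C.k C.K) :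
    (L.preLogShell : Set C.K) ⊆ Set.range (algebraMap C.k C.K) := by
  intro y hy
  have hfix : ∀ σ : C.K ≃ₐ[C.k] C.K, σ • y = y := fun σ => L.smul_eq_self_of_mem_preLogShell hy σ
  have hbot : y ∈ (⊥ : IntermediateField C.k C.K) := by
    rw [InfiniteGalois.mem_bot_iff_fixed]
    intro σ
    simpa [AlgEquiv.smul_def] using hfix σ
  obtain ⟨u, hu⟩ := IntermediateField.mem_bot.mp hbot
  exact ⟨u, hu⟩

/-- In particular, for the REAL logarithm of every `MLFClosure` (`MLFClosure.galoisPadicLog`,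
`GaloisPadicLogMLF.lean`), the pre-log-shell lies in `k`. [cite: MochizukiAbsTopIII2015, Definition 3.1 (iv) p.69] -/
theorem MLFClosure.coe_preLogShell_subset_range_algebraMap (C : MLFClosure.{0}) :
    (C.galoisPadicLog.preLogShell : Set C.K) ⊆ Set.range (algebraMap C.k C.K) :=
  C.galoisPadicLog.coe_preLogShell_subset_range_algebraMap

end Literature.AnabelianGeometry.AbsoluteAnabelian

end
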